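import Literature.Computability.MetaComplexity.EFModMulUCommLaw
import HarnessLib

/-!
# Right distributivity of uniform modular multiplication: `a ⊗ (x ⊕ y) = a ⊗ x ⊕ a ⊗ y`

Layer E/7 (uniform variant). The KIT `ModMulU.RD.rdT L` on the inputs `a, x, y, n, z`
(`4L + 1`): the left-distributivity kit `LDK = LD(x, y, a, n)`
(`R(x ⊕ y) ⊗ a = x ⊗ a ⊕ y ⊗ a`), the commutativity kits `C1` on `(a, x)`, `C2` on `(a, y)`,
`C3` on `(a, R(x ⊕ y))`, and the modular adder `AS = a ⊗ x ⊕ a ⊗ y` (on the outputs of `C1`'s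
and `C2`'s `a ⊗ ·`). The law `ModMulU.RD.isBlock_lines` chains
`a ⊗ R(x⊕y) ≡ R(x⊕y) ⊗ a ≡ VS ≡ VX ⊕ VY ≡ a ⊗ x ⊕ a ⊗ y`.

## Sources

* S. A. Cook, R. A. Reckhow, *The relative efficiency of propositional proof systems*,
  J. Symbolic Logic 44 (1979), §2.
* J. Krajíček, *Bounded Arithmetic, Propositional Logic, and Complexity Theory* (CUP 1995), §9.2.
-/

namespace Literature.Computability.MetaComplexity

open _root_.Computability Complexity Complexity.PropForm Netlist Cluster FregeSystem

namespace ModMulU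

namespace RD

variable (L : ℕ)

/-! ### The pieces -/

/-- Length of a commutativity kit. [folklore] -/
def CL (L : ℕ) : ℕ := Comm.oL L + 2 * L * Comm.LDL L + LD.RT L

/-- The pieces (kit inputs `a 0…, x L…, y 2L…, n 3L…, z 4L`). [cite: Vollmer1999, §1.2] -/
def pieces (L : ℕ) (k : ℕ) : Piece :=
  if k = 0 then ⟨LD.ldT L, 4 * L, fun i => if i < 2 * L then Sum.inl (L + i) else if i < 3 * L then Sum.inl (i - 2 * L) else Sum.inl i⟩
  else if k = 1 then ⟨Comm.commT L, 3 * L + 1, fun i => if i < L then Sum.inl i else if i < 2 * L then Sum.inl i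
    else if i < 3 * L then Sum.inl (L + i) else Sum.inl (4 * L)⟩
  else if k = 2 then ⟨Comm.commT L, 3 * L + 1, fun i => if i < L then Sum.inl i else if i < 3 * L then Sum.inl (L + i) else Sum.inl (4 * L)⟩
  else if k = 3 then ⟨Comm.commT L, 3 * L + 1, fun i => if i < L then Sum.inl i else if i < 2 * L then Sum.inr ((5 * L + 2) + (i - L))
    else if i < 3 * L then Sum.inl (L + i) else Sum.inl (4 * L)⟩
  else ⟨ModAddU.modAddT L, 3 * L, fun i => if i < L then Sum.inr (LD.pP L (Comm.LDL L + (Comm.oM L + L * LD.RT L)) L i)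
    else if i < 2 * L then Sum.inr (LD.pP L (Comm.LDL L + CL L + (Comm.oM L + L * LD.RT L)) L (i - L)) else Sum.inl (L + i)⟩

/-- **The right-distributivity kit.** [cite: Vollmer1999, §1.2–1.3] -/
def rdT (L : ℕ) : Template := layout (pieces L) 5

/-- Lengths of the pieces. [folklore] -/
theorem length_piece (hL : 0 < L) (k : ℕ) :
    (pieces L k).T.length = if k = 0 then Comm.LDL L else if k ≤ 3 then CL L else 6 * L + 2 := by
  unfold pieces
  rcases Nat.lt_or_ge k 4 with h | h
  · have : k = 0 ∨ k = 1 ∨ k = 2 ∨ k = 3 := by omega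
    rcases this with rfl | rfl | rfl | rfl
    · simp [LD.length_ldT, Comm.LDL]
    · simp [Comm.length_commT L hL, CL]
    · simp [Comm.length_commT L hL, CL]
    · simp [Comm.length_commT L hL, CL]
  · rw [if_neg (show ¬k = 0 by omega), if_neg (show ¬k = 1 by omega), if_neg (show ¬k = 2 by omega), if_neg (show ¬k = 3 by omega),
      if_neg (show ¬k = 0 by omega), if_neg (show ¬k ≤ 3 by omega)]; simp

/-- The offsets. [folklore] -/
theorem offset_pieces (hL : 0 < L) : offset (pieces L) 1 = Comm.LDL L ∧ offset (pieces L) 2 = Comm.LDL L + CL L ∧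
    offset (pieces L) 3 = Comm.LDL L + 2 * CL L ∧ offset (pieces L) 4 = Comm.LDL L + 3 * CL L ∧
    offset (pieces L) 5 = Comm.LDL L + 3 * CL L + (6 * L + 2) := by
  have o1 : offset (pieces L) 1 = Comm.LDL L := by rw [offset_succ, offset_zero, length_piece L hL]; simp
  have o2 : offset (pieces L) 2 = Comm.LDL L + CL L := by rw [offset_succ, o1, length_piece L hL]; simp
  have o3 : offset (pieces L) 3 = Comm.LDL L + 2 * CL L := by rw [offset_succ, o2, length_piece L hL]; simp; ring
  have o4 : offset (pieces L) 4 = Comm.LDL L + 3 * CL L := by rw [offset_succ, o3, length_piece L hL]; simp; ring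
  have o5 : offset (pieces L) 5 = Comm.LDL L + 3 * CL L + (6 * L + 2) := by rw [offset_succ, o4, length_piece L hL]; simp
  exact ⟨o1, o2, o3, o4, o5⟩

/-- A gate of `a ⊗ ·`'s output inside a commutativity kit lies inside it. [folklore] -/
theorem outM_lt {oV i : ℕ} (hi : i < L) : LD.pP L (oV + (Comm.oM L + L * LD.RT L)) L i < oV + CL L := by
  have := LD.pP_lt L (oV := oV + (Comm.oM L + L * LD.RT L)) (t := L) le_rfl hi
  unfold CL Comm.oL; nlinarith [Nat.zero_le (Comm.LDL L)]

/-- Every piece is well formed and well wired. [cite: Vollmer1999, Def. 1.6] -/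
theorem piece_ok (hL : 0 < L) : ∀ k < 5, Piece.OK (pieces L) (4 * L + 1) k := by
  intro k hk
  have hR : 5 * L + 2 + L ≤ Comm.LDL L := by unfold Comm.LDL LD.o4; nlinarith [Nat.zero_le (LD.RT L), Nat.zero_le (LD.MF L)]
  obtain ⟨o1, o2, o3, o4, -⟩ := offset_pieces L hL
  have : k = 0 ∨ k = 1 ∨ k = 2 ∨ k = 3 ∨ k = 4 := by omega
  unfold Piece.OK
  rcases this with rfl | rfl | rfl | rfl | rfl
  · simp only [pieces, if_true]
    exact ⟨LD.wf_ldT L, fun i hi => by split_ifs <;> exact ⟨fun a ha => (by cases ha; omega), fun g hg => by cases hg⟩⟩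
  · rw [o1]; simp only [pieces, show (1 : ℕ) ≠ 0 from by decide, if_false, if_true]
    exact ⟨Comm.wf_commT L hL, fun i hi => by split_ifs <;> exact ⟨fun a ha => (by cases ha; omega), fun g hg => by cases hg⟩⟩
  · rw [o2]; simp only [pieces, show (2 : ℕ) ≠ 0 from by decide, show (2 : ℕ) ≠ 1 from by decide, if_false, if_true]
    exact ⟨Comm.wf_commT L hL, fun i hi => by split_ifs <;> exact ⟨fun a ha => (by cases ha; omega), fun g hg => by cases hg⟩⟩
  · rw [o3]; simp only [pieces, show (3 : ℕ) ≠ 0 from by decide, show (3 : ℕ) ≠ 1 from by decide, show (3 : ℕ) ≠ 2 from by decide, if_false, if_true]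
    refine ⟨Comm.wf_commT L hL, fun i hi => ?_⟩
    split_ifs
    · exact ⟨fun a ha => (by cases ha; omega), fun g hg => by cases hg⟩
    · exact ⟨fun a ha => (by cases ha), fun g hg => by cases hg; omega⟩
    · exact ⟨fun a ha => (by cases ha; omega), fun g hg => by cases hg⟩
    · exact ⟨fun a ha => (by cases ha; omega), fun g hg => by cases hg⟩
  · rw [o4]; simp only [pieces, show (4 : ℕ) ≠ 0 from by decide, show (4 : ℕ) ≠ 1 from by decide, show (4 : ℕ) ≠ 2 from by decide,
      show (4 : ℕ) ≠ 3 from by decide, if_false]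
    refine ⟨ModAddU.wf_modAddT L, fun i hi => ?_⟩
    split_ifs with h1 h2
    · exact ⟨fun a ha => (by cases ha), fun g hg => by cases hg; have := outM_lt L (oV := Comm.LDL L) h1; omega⟩
    · exact ⟨fun a ha => (by cases ha), fun g hg => by
        cases hg; have := outM_lt L (oV := Comm.LDL L + CL L) (i := i - L) (by omega); omega⟩
    · exact ⟨fun a ha => (by cases ha; omega), fun g hg => by cases hg⟩

/-- **The kit is well formed** (`4L + 1` inputs). [cite: Vollmer1999, Def. 1.6] -/
theorem wf_rdT (hL : 0 < L) : (rdT L).WF (4 * L + 1) := wf_layout (pieces L) (piece_ok L hL)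

/-! ### The views of an occurrence -/

section Views

variable (o : Occ)

/-- The occurrence of `LDK`. [folklore] -/
def LDK : Occ := pieceOcc (o.inst (4 * L + 1)) (pieces L) 0
/-- The occurrence of `C1` (on `a, x`). [folklore] -/
def C1 : Occ := pieceOcc (o.inst (4 * L + 1)) (pieces L) 1
/-- The occurrence of `C2` (on `a, y`). [folklore] -/
def C2 : Occ := pieceOcc (o.inst (4 * L + 1)) (pieces L) 2
/-- The occurrence of `C3` (on `a, R(x ⊕ y)`). [folklore] -/
def C3 : Occ := pieceOcc (o.inst (4 * L + 1)) (pieces L) 3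
/-- The modulus. [folklore] -/
def nv (i : ℕ) : ℕ := o.inp (3 * L + i)
/-- `AS = a ⊗ x ⊕ a ⊗ y`. [folklore] -/
def AS : ModAddU.View :=
  ⟨o.base + (Comm.LDL L + 3 * CL L), (Comm.M L (C1 L o) L).P L L, (Comm.M L (C2 L o) L).P L L, nv L o⟩

/-- All pieces of the kit are available. [folklore] -/
structure RAvl (K : PropForm ℕ) (Γ : Set (PropForm ℕ)) : Prop where
  /-- `LDK` -/
  hLDK : (LDK L o).Avail (LD.ldT L) (4 * L) K Γ
  /-- `C1` -/
  hC1 : (C1 L o).Avail (Comm.commT L) (3 * L + 1) K Γ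
  /-- `C2` -/
  hC2 : (C2 L o).Avail (Comm.commT L) (3 * L + 1) K Γ
  /-- `C3` -/
  hC3 : (C3 L o).Avail (Comm.commT L) (3 * L + 1) K Γ
  /-- `AS` -/
  hAS : (AS L o).Avail K Γ L

end Views

variable {L} {o : Occ} {K : PropForm ℕ} {Γ : Set (PropForm ℕ)}

/-- **All pieces of an available occurrence are available.** [folklore] -/
theorem avail_ofOcc (hL : 0 < L) (ho : o.Avail (rdT L) (4 * L + 1) K Γ) : RAvl L o K Γ := by
  obtain ⟨o1, o2, o3, o4, -⟩ := offset_pieces L hL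
  have p0 : pieces L 0 = ⟨LD.ldT L, 4 * L, fun i => if i < 2 * L then Sum.inl (L + i) else if i < 3 * L then Sum.inl (i - 2 * L) else Sum.inl i⟩ := rfl
  have p1 : pieces L 1 = ⟨Comm.commT L, 3 * L + 1, fun i => if i < L then Sum.inl i else if i < 2 * L then Sum.inl i
    else if i < 3 * L then Sum.inl (L + i) else Sum.inl (4 * L)⟩ := rfl
  have p2 : pieces L 2 = ⟨Comm.commT L, 3 * L + 1, fun i => if i < L then Sum.inl i else if i < 3 * L then Sum.inl (L + i) else Sum.inl (4 * L)⟩ := rfl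
  have p3 : pieces L 3 = ⟨Comm.commT L, 3 * L + 1, fun i => if i < L then Sum.inl i else if i < 2 * L then Sum.inr ((5 * L + 2) + (i - L))
    else if i < 3 * L then Sum.inl (L + i) else Sum.inl (4 * L)⟩ := rfl
  have p4 : pieces L 4 = ⟨ModAddU.modAddT L, 3 * L, fun i => if i < L then Sum.inr (LD.pP L (Comm.LDL L + (Comm.oM L + L * LD.RT L)) L i)
    else if i < 2 * L then Sum.inr (LD.pP L (Comm.LDL L + CL L + (Comm.oM L + L * LD.RT L)) L (i - L)) else Sum.inl (L + i)⟩ := rfl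
  refine ⟨?_, ?_, ?_, ?_, ?_⟩
  · have := Inst.DefsAvail.piece ho (k := 0) (by omega) (by rw [p0]; exact LD.wf_ldT L); rw [p0] at this; exact this
  · have := Inst.DefsAvail.piece ho (k := 1) (by omega) (by rw [p1]; exact Comm.wf_commT L hL); rw [p1] at this; exact this
  · have := Inst.DefsAvail.piece ho (k := 2) (by omega) (by rw [p2]; exact Comm.wf_commT L hL); rw [p2] at this; exact this
  · have := Inst.DefsAvail.piece ho (k := 3) (by omega) (by rw [p3]; exact Comm.wf_commT L hL); rw [p3] at this; exact this
  · have hq : (pieceOcc (o.inst (4 * L + 1)) (pieces L) 4).Avail (ModAddU.modAddT L) (3 * L) K Γ := by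
      have := Inst.DefsAvail.piece ho (k := 4) (by omega) (by rw [p4]; exact ModAddU.wf_modAddT L); rw [p4] at this; exact this
    have eM : ∀ (O : Occ) (d : ℕ), O.base = o.base + d → ∀ i, (Comm.M L O L).P L L i = o.base + LD.pP L (d + (Comm.oM L + L * LD.RT L)) L i := by
      intro O d hO i
      unfold Comm.M View.P LD.pP
      rw [hO]
      split_ifs <;> simp [Nat.add_assoc]
    have b1 : (C1 L o).base = o.base + Comm.LDL L := by simp [C1, pieceOcc, o1]
    have b2 : (C2 L o).base = o.base + (Comm.LDL L + CL L) := by simp [C2, pieceOcc, o2]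
    refine ModAddU.View.Avail.congr (ModAddU.avail_viewOf hq) ?_ (fun i hi => ?_) (fun i hi => ?_) (fun i hi => ?_)
    · show o.base + (Comm.LDL L + 3 * CL L) = (pieceOcc (o.inst (4 * L + 1)) (pieces L) 4).base; simp [pieceOcc, o4]
    · show (Comm.M L (C1 L o) L).P L L i = ((pieceOcc (o.inst (4 * L + 1)) (pieces L) 4).inst (3 * L)).inputs.getD i 0
      rw [Occ.getD_inst _ (show i < 3 * L by omega), inp_pieceOcc, p4]; dsimp only; rw [if_pos hi, Occ.ref_inr]
      rw [eM (C1 L o) _ b1 i]; rfl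
    · show (Comm.M L (C2 L o) L).P L L i = ((pieceOcc (o.inst (4 * L + 1)) (pieces L) 4).inst (3 * L)).inputs.getD (L + i) 0
      rw [Occ.getD_inst _ (show L + i < 3 * L by omega), inp_pieceOcc, p4]; dsimp only
      rw [if_neg (show ¬L + i < L by omega), if_pos (show L + i < 2 * L by omega), Nat.add_sub_cancel_left, Occ.ref_inr]
      rw [eM (C2 L o) _ b2 i]; rfl
    · show o.inp (3 * L + i) = ((pieceOcc (o.inst (4 * L + 1)) (pieces L) 4).inst (3 * L)).inputs.getD (2 * L + i) 0
      rw [Occ.getD_inst _ (show 2 * L + i < 3 * L by omega), inp_pieceOcc, p4]; dsimp only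
      rw [if_neg (show ¬2 * L + i < L by omega), if_neg (show ¬2 * L + i < 2 * L by omega), Occ.ref_inl o (by omega)]; congr 1; omega

/-! ### The inputs of the pieces -/

/-- The inputs of `LDK`: `(x, y, a, n)`. [folklore] -/
theorem LDK_inp {i : ℕ} (hi : i < L) : (LDK L o).inp i = o.inp (L + i) ∧ (LDK L o).inp (L + i) = o.inp (2 * L + i) ∧
    (LDK L o).inp (2 * L + i) = o.inp i ∧ (LDK L o).inp (3 * L + i) = o.inp (3 * L + i) := by
  have e : ∀ j, (LDK L o).inp j = (o.inst (4 * L + 1)).ref ((pieces L 0).wire j) := fun j => inp_pieceOcc _ _ _ _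
  have p0 : ∀ j, (pieces L 0).wire j = if j < 2 * L then Sum.inl (L + j) else if j < 3 * L then Sum.inl (j - 2 * L) else Sum.inl j := fun j => rfl
  refine ⟨?_, ?_, ?_, ?_⟩
  · rw [e, p0, if_pos (by omega)]; exact Occ.ref_inl o (by omega)
  · rw [e, p0, if_pos (by omega), show L + (L + i) = 2 * L + i by omega]; exact Occ.ref_inl o (by omega)
  · rw [e, p0, if_neg (by omega), if_pos (by omega), show 2 * L + i - 2 * L = i by omega]; exact Occ.ref_inl o (by omega)
  · rw [e, p0, if_neg (by omega), if_neg (by omega)]; exact Occ.ref_inl o (by omega)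

/-- The inputs of `C1`: `(a, x, n, z)`. [folklore] -/
theorem C1_inp {i : ℕ} (hi : i < L) : (C1 L o).inp i = o.inp i ∧ (C1 L o).inp (L + i) = o.inp (L + i) ∧
    (C1 L o).inp (2 * L + i) = o.inp (3 * L + i) ∧ (C1 L o).inp (3 * L) = o.inp (4 * L) := by
  have e : ∀ j, (C1 L o).inp j = (o.inst (4 * L + 1)).ref ((pieces L 1).wire j) := fun j => inp_pieceOcc _ _ _ _
  have p1 : ∀ j, (pieces L 1).wire j = if j < L then Sum.inl j else if j < 2 * L then Sum.inl j
    else if j < 3 * L then Sum.inl (L + j) else Sum.inl (4 * L) := fun j => rfl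
  refine ⟨?_, ?_, ?_, ?_⟩
  · rw [e, p1, if_pos hi]; exact Occ.ref_inl o (by omega)
  · rw [e, p1, if_neg (by omega), if_pos (by omega)]; exact Occ.ref_inl o (by omega)
  · rw [e, p1, if_neg (by omega), if_neg (by omega), if_pos (by omega), show L + (2 * L + i) = 3 * L + i by omega]; exact Occ.ref_inl o (by omega)
  · rw [e, p1, if_neg (by omega), if_neg (by omega), if_neg (by omega)]; exact Occ.ref_inl o (by omega)

/-- The inputs of `C2`: `(a, y, n, z)`. [folklore] -/
theorem C2_inp {i : ℕ} (hi : i < L) : (C2 L o).inp i = o.inp i ∧ (C2 L o).inp (L + i) = o.inp (2 * L + i) ∧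
    (C2 L o).inp (2 * L + i) = o.inp (3 * L + i) ∧ (C2 L o).inp (3 * L) = o.inp (4 * L) := by
  have e : ∀ j, (C2 L o).inp j = (o.inst (4 * L + 1)).ref ((pieces L 2).wire j) := fun j => inp_pieceOcc _ _ _ _
  have p2 : ∀ j, (pieces L 2).wire j = if j < L then Sum.inl j else if j < 3 * L then Sum.inl (L + j) else Sum.inl (4 * L) := fun j => rfl
  refine ⟨?_, ?_, ?_, ?_⟩
  · rw [e, p2, if_pos hi]; exact Occ.ref_inl o (by omega)
  · rw [e, p2, if_neg (by omega), if_pos (by omega), show L + (L + i) = 2 * L + i by omega]; exact Occ.ref_inl o (by omega)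
  · rw [e, p2, if_neg (by omega), if_pos (by omega), show L + (2 * L + i) = 3 * L + i by omega]; exact Occ.ref_inl o (by omega)
  · rw [e, p2, if_neg (by omega), if_neg (by omega)]; exact Occ.ref_inl o (by omega)

/-- The inputs of `C3`: `(a, R(x ⊕ y), n, z)`. [folklore] -/
theorem C3_inp {i : ℕ} (hi : i < L) : (C3 L o).inp i = o.inp i ∧ (C3 L o).inp (L + i) = (LD.MS L (LDK L o)).R L i ∧
    (C3 L o).inp (2 * L + i) = o.inp (3 * L + i) ∧ (C3 L o).inp (3 * L) = o.inp (4 * L) := by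
  have e : ∀ j, (C3 L o).inp j = (o.inst (4 * L + 1)).ref ((pieces L 3).wire j) := fun j => inp_pieceOcc _ _ _ _
  have p3 : ∀ j, (pieces L 3).wire j = if j < L then Sum.inl j else if j < 2 * L then Sum.inr ((5 * L + 2) + (j - L))
    else if j < 3 * L then Sum.inl (L + j) else Sum.inl (4 * L) := fun j => rfl
  refine ⟨?_, ?_, ?_, ?_⟩
  · rw [e, p3, if_pos hi]; exact Occ.ref_inl o (by omega)
  · rw [e, p3, if_neg (by omega), if_pos (by omega), Nat.add_sub_cancel_left, Occ.ref_inr]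
    show o.base + (5 * L + 2 + i) = (LDK L o).base + (5 * L + 2) + i
    rw [show (LDK L o).base = o.base + 0 from by simp [LDK, pieceOcc, offset_zero]]; omega
  · rw [e, p3, if_neg (by omega), if_neg (by omega), if_pos (by omega), show L + (2 * L + i) = 3 * L + i by omega]; exact Occ.ref_inl o (by omega)
  · rw [e, p3, if_neg (by omega), if_neg (by omega), if_neg (by omega)]; exact Occ.ref_inl o (by omega)

/-! ### The law -/

section Law

variable (L) (o : Occ) (K : PropForm ℕ) (m : ℕ)

/-- The range data of `R(x ⊕ y)`. [folklore] -/
def lt : ModAddU.LtData := ⟨LD.MS L (LDK L o), L, (LD.VX L (LDK L o)).rbase L 1, (LD.VY L (LDK L o)).rbase L 1, (C3 L o).base + (3 * L + 1)⟩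

/-- The segments of the law. [folklore] -/
def segs : List (List (PropForm ℕ)) :=
  [ModAddU.AssocKit.transferLines (Comm.CmpB L (C1 L o)) ((LD.VX L (LDK L o)).CA L) K L,      -- 0 x < n
   ModAddU.AssocKit.transferLines (Comm.CmpB L (C2 L o)) ((LD.VY L (LDK L o)).CA L) K L,      -- 1 y < n
   ModAddU.AssocKit.transferLines (Comm.CmpA L (C1 L o)) (Comm.CmpA L (C2 L o)) K L,          -- 2 a < n
   ModAddU.AssocKit.transferLines (Comm.CmpA L (C1 L o)) (Comm.CmpA L (C3 L o)) K L,          -- 3 a < n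
   (lt L o).lines K,                                                                           -- 4 R(x⊕y) < n
   LD.lines L (LDK L o) K m,                                                                   -- 5
   Comm.lines L (C1 L o) K m,                                                                  -- 6
   Comm.lines L (C2 L o) K m,                                                                  -- 7
   Comm.lines L (C3 L o) K m,                                                                  -- 8
   Adder.reflLines K ((List.range L).map o.inp ++ (List.range L).map (fun i => o.inp (L + i)) ++ (List.range L).map (fun i => o.inp (2 * L + i)) ++
     (List.range L).map (nv L o) ++ (List.range L).map ((LD.MS L (LDK L o)).R L)),            -- 9
   (⟨Comm.BA L (C3 L o), LD.VS L (LDK L o), L⟩ : PairData).lines K,                           -- 10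
   (⟨LD.VX L (LDK L o), Comm.BA L (C1 L o), L⟩ : PairData).lines K,                           -- 11
   (⟨LD.VY L (LDK L o), Comm.BA L (C2 L o), L⟩ : PairData).lines K,                           -- 12
   ModAddU.MFI.symmLines K ((Comm.M L (C1 L o) L).P L L) ((Comm.BA L (C1 L o)).P L L) L,      -- 13
   ModAddU.MFI.symmLines K ((Comm.M L (C2 L o) L).P L L) ((Comm.BA L (C2 L o)).P L L) L,      -- 14
   ModAddU.MFI.transLines K ((LD.VX L (LDK L o)).P L L) ((Comm.M L (C1 L o) L).P L L) L,      -- 15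
   ModAddU.MFI.transLines K ((LD.VY L (LDK L o)).P L L) ((Comm.M L (C2 L o) L).P L L) L,      -- 16
   (⟨LD.RL L (LDK L o), AS L o, L⟩ : ModAddU.PairData).leibLines K,                           -- 17
   ModAddU.MFI.transLines K ((Comm.M L (C3 L o) L).P L L) ((LD.VS L (LDK L o)).P L L) L,      -- 18
   ModAddU.MFI.transLines K ((Comm.M L (C3 L o) L).P L L) (fun i => (LD.RL L (LDK L o)).R L i) L,   -- 19
   ModAddU.MFI.transLines K ((Comm.M L (C3 L o) L).P L L) (fun i => (AS L o).R L i) L]               -- 20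

/-- **The lines of the right-distributivity law.** [folklore] -/
def lines : List (PropForm ℕ) := (segs L o K m).flatten

end Law

/-- The length of the segment list. [folklore] -/
theorem length_segs (L : ℕ) (o : Occ) (K : PropForm ℕ) (m : ℕ) : (segs L o K m).length = 21 := rfl


variable {G : FregeSystem}

/-- **Right distributivity of modular multiplication inside Frege.** For an available occurrence
of the kit with `a, x, y < n` (facts about `C1`'s comparators `(a, n)`, `(x, n)` and `C2`'s
`(y, n)`), the zero gate `z` (`z ↔ ⊥`), `0 < L`, `m + 2 ≤ L` and the high bits of `n` false
from `m` on, the lines form a block concluding `P_L(a ⊗ R(x ⊕ y)) ≡ R(AS)`: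
`a ⊗ (x ⊕ y) = a ⊗ x ⊕ a ⊗ y` bitwise. [cite: CookReckhow1979, §2; Krajicek1995, §9.2] -/
theorem isBlock_lines (hGC : ∀ r ∈ Comm.rules, r ∈ G.rules) (hGO : ∀ r ∈ One.rules, r ∈ G.rules) (hGS : ∀ r ∈ Sys.glue, r ∈ G.rules)
    (hGY : ∀ r ∈ Sys.sysRules, r ∈ G.rules) (hGN : ∀ r ∈ Netlist.rules, r ∈ G.rules) (hGA : ∀ r ∈ Adder.rules, r ∈ G.rules)
    (hGL : ∀ r ∈ Logic.rules, r ∈ G.rules) (hG : ∀ r ∈ ModAddU.assocRules, r ∈ G.rules) (hGM : ∀ r ∈ ModAddU.rules, r ∈ G.rules)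
    (hGR : ∀ r ∈ rangeRules, r ∈ G.rules) (hGG : ∀ r ∈ ModAddU.glueRules, r ∈ G.rules) (hGK : ∀ r ∈ LD.maskRules, r ∈ G.rules)
    (hL : 0 < L) (h : RAvl L o K Γ) {m : ℕ} (hm : m + 2 ≤ L) (hzdef : ctx K (biimp (var (o.inp (4 * L))) (const false)) ∈ Γ)
    (hlta : ctx K (neg (var ((Comm.CmpA L (C1 L o)).ge L L))) ∈ Γ) (hltx : ctx K (neg (var ((Comm.CmpB L (C1 L o)).ge L L))) ∈ Γ)
    (hlty : ctx K (neg (var ((Comm.CmpB L (C2 L o)).ge L L))) ∈ Γ)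
    (hnh : ∀ i, m ≤ i → i < L → ctx K (neg (var (o.inp (3 * L + i)))) ∈ Γ) : G.IsBlock Γ (lines L o K m) := by
  have hK := LD.avail_ofOcc h.hLDK
  have h1 := Comm.avail_ofOcc hL h.hC1
  have h2 := Comm.avail_ofOcc hL h.hC2
  have h3 := Comm.avail_ofOcc hL h.hC3
  have z1 : Comm.zv L (C1 L o) = o.inp (4 * L) := (C1_inp hL).2.2.2
  have z2 : Comm.zv L (C2 L o) = o.inp (4 * L) := (C2_inp hL).2.2.2
  have z3 : Comm.zv L (C3 L o) = o.inp (4 * L) := (C3_inp hL).2.2.2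
  refine ModAddU.AssocData.isBlock_flatten _ fun k hk => ?_
  rw [length_segs] at hk
  have mem : ∀ {χ} (j : ℕ) (hj : j < k) (hχ : χ ∈ (segs L o K m)[j]'(by rw [length_segs]; omega)),
      χ ∈ Γ ∪ {χ | ∃ j, ∃ hj : j < k, χ ∈ (segs L o K m)[j]'(by rw [length_segs]; omega)} := fun j hj hχ => Or.inr ⟨j, hj, hχ⟩
  have hΓ : Γ ⊆ Γ ∪ {χ | ∃ j, ∃ hj : j < k, χ ∈ (segs L o K m)[j]'(by rw [length_segs]; omega)} := fun _ hχ => Or.inl hχ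
  have mr : ∀ {f : ℕ → PropForm ℕ} {W i : ℕ}, i < W → f i ∈ (List.range W).map f := fun hi => List.mem_map.2 ⟨_, List.mem_range.2 hi, rfl⟩
  have rf : 9 < k → ∀ (w : ℕ) (z : ℕ → ℕ), (w = 0 ∧ z = o.inp ∨ w = 1 ∧ z = (fun i => o.inp (L + i)) ∨ w = 2 ∧ z = (fun i => o.inp (2 * L + i)) ∨
      w = 3 ∧ z = nv L o ∨ w = 4 ∧ z = (LD.MS L (LDK L o)).R L) → ∀ i < L,
      ctx K (eqv (z i) (z i)) ∈ Γ ∪ {χ | ∃ j, ∃ hj : j < k, χ ∈ (segs L o K m)[j]'(by rw [length_segs]; omega)} := by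
    intro hk0 w z hz i hi
    refine mem 9 hk0 (Adder.mem_reflLines ?_)
    simp only [List.mem_append, List.mem_map, List.mem_range]
    rcases hz with ⟨-, rfl⟩ | ⟨-, rfl⟩ | ⟨-, rfl⟩ | ⟨-, rfl⟩ | ⟨-, rfl⟩
    · exact Or.inl (Or.inl (Or.inl (Or.inl ⟨i, hi, rfl⟩)))
    · exact Or.inl (Or.inl (Or.inl (Or.inr ⟨i, hi, rfl⟩)))
    · exact Or.inl (Or.inl (Or.inr ⟨i, hi, rfl⟩))
    · exact Or.inl (Or.inr ⟨i, hi, rfl⟩)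
    · exact Or.inr ⟨i, hi, rfl⟩
  interval_cases k
  · exact ModAddU.AssocKit.isBlock_transferLines hGN hGA hGL (h1.hB.mono hΓ) (hK.hVX.hCA.mono hΓ)
      (fun i hi => by show (C1 L o).inp (L + i) = (LDK L o).inp i; rw [(C1_inp hi).2.1, (LDK_inp hi).1])
      (fun i hi => by show (C1 L o).inp (2 * L + i) = (LDK L o).inp (3 * L + i); rw [(C1_inp hi).2.2.1, (LDK_inp hi).2.2.2]) (hΓ hltx)
  · exact ModAddU.AssocKit.isBlock_transferLines hGN hGA hGL (h2.hB.mono hΓ) (hK.hVY.hCA.mono hΓ)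
      (fun i hi => by show (C2 L o).inp (L + i) = (LDK L o).inp (L + i); rw [(C2_inp hi).2.1, (LDK_inp hi).2.1])
      (fun i hi => by show (C2 L o).inp (2 * L + i) = (LDK L o).inp (3 * L + i); rw [(C2_inp hi).2.2.1, (LDK_inp hi).2.2.2]) (hΓ hlty)
  · exact ModAddU.AssocKit.isBlock_transferLines hGN hGA hGL (h1.hA.mono hΓ) (h2.hA.mono hΓ)
      (fun i hi => by show (C1 L o).inp i = (C2 L o).inp i; rw [(C1_inp hi).1, (C2_inp hi).1])
      (fun i hi => by show (C1 L o).inp (2 * L + i) = (C2 L o).inp (2 * L + i); rw [(C1_inp hi).2.2.1, (C2_inp hi).2.2.1]) (hΓ hlta)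
  · exact ModAddU.AssocKit.isBlock_transferLines hGN hGA hGL (h1.hA.mono hΓ) (h3.hA.mono hΓ)
      (fun i hi => by show (C1 L o).inp i = (C3 L o).inp i; rw [(C1_inp hi).1, (C3_inp hi).1])
      (fun i hi => by show (C1 L o).inp (2 * L + i) = (C3 L o).inp (2 * L + i); rw [(C1_inp hi).2.2.1, (C3_inp hi).2.2.1]) (hΓ hlta)
  · -- 4: `R(x ⊕ y) < n`
    refine (lt L o).isBlock_lines hGM hGA (hK.hMS.mono hΓ) (hK.hVX.hCA.mono hΓ) (hK.hVY.hCA.mono hΓ) ?_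
      (mem 0 (by omega) (ModAddU.AssocKit.mem_transferLines _ _ _ _)) (mem 1 (by omega) (ModAddU.AssocKit.mem_transferLines _ _ _ _))
    exact Sub.View.Avail.congr (h3.hB.mono hΓ) rfl (fun i hi => ((C3_inp (L := L) (o := o) hi).2.1).symm)
      (fun i hi => by
        show (LDK L o).inp (3 * L + i) = (C3 L o).inp (2 * L + i)
        rw [(LDK_inp (L := L) (o := o) (show i < L from hi)).2.2.2, (C3_inp (L := L) (o := o) (show i < L from hi)).2.2.1])
  · -- 5: left distributivity
    refine LD.isBlock_lines hG hGM hGR hGN hGA hGL hGG hGK (hK.mono hΓ) hm (mem 0 (by omega) (ModAddU.AssocKit.mem_transferLines _ _ _ _))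
      (mem 1 (by omega) (ModAddU.AssocKit.mem_transferLines _ _ _ _)) fun i h₁ h₂ => ?_
    show ctx K (neg (var ((LDK L o).inp (3 * L + i)))) ∈ _; rw [(LDK_inp h₂).2.2.2]; exact hΓ (hnh i h₁ h₂)
  · -- 6: commutativity `a ⊗ x = x ⊗ a`
    refine Comm.isBlock_lines hGC hGO hGS hGY hGN hGA hGL hG hGM hGR hGG hGK hL (by exact ⟨h1.hA.mono hΓ, h1.hB.mono hΓ, h1.hShB.mono hΓ,
      h1.hOneA.mono hΓ, fun s hs => (h1.hM s hs).mono hΓ, fun s hs => (h1.hLD1 s hs).mono hΓ, fun s hs => (h1.hLD2 s hs).mono hΓ,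
      h1.hBA.mono hΓ⟩) hm (by rw [z1]; exact hΓ hzdef) (hΓ hlta) (hΓ hltx) fun i h₁ h₂ => ?_
    show ctx K (neg (var ((C1 L o).inp (2 * L + i)))) ∈ _; rw [(C1_inp h₂).2.2.1]; exact hΓ (hnh i h₁ h₂)
  · -- 7: `a ⊗ y = y ⊗ a`
    refine Comm.isBlock_lines hGC hGO hGS hGY hGN hGA hGL hG hGM hGR hGG hGK hL (by exact ⟨h2.hA.mono hΓ, h2.hB.mono hΓ, h2.hShB.mono hΓ,
      h2.hOneA.mono hΓ, fun s hs => (h2.hM s hs).mono hΓ, fun s hs => (h2.hLD1 s hs).mono hΓ, fun s hs => (h2.hLD2 s hs).mono hΓ,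
      h2.hBA.mono hΓ⟩) hm (by rw [z2]; exact hΓ hzdef) (mem 2 (by omega) (ModAddU.AssocKit.mem_transferLines _ _ _ _)) (hΓ hlty)
      fun i h₁ h₂ => ?_
    show ctx K (neg (var ((C2 L o).inp (2 * L + i)))) ∈ _; rw [(C2_inp h₂).2.2.1]; exact hΓ (hnh i h₁ h₂)
  · -- 8: `a ⊗ R(x⊕y) = R(x⊕y) ⊗ a`
    refine Comm.isBlock_lines hGC hGO hGS hGY hGN hGA hGL hG hGM hGR hGG hGK hL (by exact ⟨h3.hA.mono hΓ, h3.hB.mono hΓ, h3.hShB.mono hΓ,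
      h3.hOneA.mono hΓ, fun s hs => (h3.hM s hs).mono hΓ, fun s hs => (h3.hLD1 s hs).mono hΓ, fun s hs => (h3.hLD2 s hs).mono hΓ,
      h3.hBA.mono hΓ⟩) hm (by rw [z3]; exact hΓ hzdef) (mem 3 (by omega) (ModAddU.AssocKit.mem_transferLines _ _ _ _))
      (mem 4 (by omega) (lt L o).mem_lines) fun i h₁ h₂ => ?_
    show ctx K (neg (var ((C3 L o).inp (2 * L + i)))) ∈ _; rw [(C3_inp h₂).2.2.1]; exact hΓ (hnh i h₁ h₂)
  · -- 9: reflexivity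
    exact Adder.isBlock_reflLines hGA _ _ _
  · -- 10: `R(x⊕y) ⊗ a` (of `C3`) `≡ VS`
    refine (⟨Comm.BA L (C3 L o), LD.VS L (LDK L o), L⟩ : PairData).isBlock_lines hGN hGL (h3.hBA.hV.mono hΓ) (hK.hVS.hV.mono hΓ)
      (fun i hi => ?_) (fun i hi => ?_) (fun i hi => ?_)
    · show ctx K (eqv ((C3 L o).inp (L + i)) ((LD.MS L (LDK L o)).R L i)) ∈ _
      rw [(C3_inp hi).2.1]; exact rf (by omega) 4 ((LD.MS L (LDK L o)).R L) (by simp) i hi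
    · show ctx K (eqv ((C3 L o).inp i) ((LDK L o).inp (2 * L + i))) ∈ _
      rw [(C3_inp hi).1, (LDK_inp hi).2.2.1]; exact rf (by omega) 0 o.inp (by simp) i hi
    · show ctx K (eqv ((C3 L o).inp (2 * L + i)) ((LDK L o).inp (3 * L + i))) ∈ _
      rw [(C3_inp hi).2.2.1, (LDK_inp hi).2.2.2]; exact rf (by omega) 3 (nv L o) (by simp) i hi
  · -- 11: `VX ≡ x ⊗ a` (of `C1`)
    refine (⟨LD.VX L (LDK L o), Comm.BA L (C1 L o), L⟩ : PairData).isBlock_lines hGN hGL (hK.hVX.hV.mono hΓ) (h1.hBA.hV.mono hΓ)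
      (fun i hi => ?_) (fun i hi => ?_) (fun i hi => ?_)
    · show ctx K (eqv ((LDK L o).inp i) ((C1 L o).inp (L + i))) ∈ _
      rw [(LDK_inp hi).1, (C1_inp hi).2.1]; exact rf (by omega) 1 (fun i => o.inp (L + i)) (by simp) i hi
    · show ctx K (eqv ((LDK L o).inp (2 * L + i)) ((C1 L o).inp i)) ∈ _
      rw [(LDK_inp hi).2.2.1, (C1_inp hi).1]; exact rf (by omega) 0 o.inp (by simp) i hi
    · show ctx K (eqv ((LDK L o).inp (3 * L + i)) ((C1 L o).inp (2 * L + i))) ∈ _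
      rw [(LDK_inp hi).2.2.2, (C1_inp hi).2.2.1]; exact rf (by omega) 3 (nv L o) (by simp) i hi
  · -- 12: `VY ≡ y ⊗ a` (of `C2`)
    refine (⟨LD.VY L (LDK L o), Comm.BA L (C2 L o), L⟩ : PairData).isBlock_lines hGN hGL (hK.hVY.hV.mono hΓ) (h2.hBA.hV.mono hΓ)
      (fun i hi => ?_) (fun i hi => ?_) (fun i hi => ?_)
    · show ctx K (eqv ((LDK L o).inp (L + i)) ((C2 L o).inp (L + i))) ∈ _
      rw [(LDK_inp hi).2.1, (C2_inp hi).2.1]; exact rf (by omega) 2 (fun i => o.inp (2 * L + i)) (by simp) i hi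
    · show ctx K (eqv ((LDK L o).inp (2 * L + i)) ((C2 L o).inp i)) ∈ _
      rw [(LDK_inp hi).2.2.1, (C2_inp hi).1]; exact rf (by omega) 0 o.inp (by simp) i hi
    · show ctx K (eqv ((LDK L o).inp (3 * L + i)) ((C2 L o).inp (2 * L + i))) ∈ _
      rw [(LDK_inp hi).2.2.2, (C2_inp hi).2.2.1]; exact rf (by omega) 3 (nv L o) (by simp) i hi
  · -- 13: symmetry of `C1`'s conclusion
    exact ModAddU.MFI.isBlock_symmLines hGL K fun i hi => mem 6 (by omega) (Comm.mem_lines hL hi)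
  · -- 14
    exact ModAddU.MFI.isBlock_symmLines hGL K fun i hi => mem 7 (by omega) (Comm.mem_lines hL hi)
  · -- 15: `VX.out ≡ a ⊗ x`
    exact ModAddU.MFI.isBlock_transLines hGL K
      (fun i hi => mem 11 (by omega) ((⟨LD.VX L (LDK L o), Comm.BA L (C1 L o), L⟩ : PairData).mem_lines hi)) (fun i hi => mem 13 (by omega) (mr hi))
  · -- 16
    exact ModAddU.MFI.isBlock_transLines hGL K
      (fun i hi => mem 12 (by omega) ((⟨LD.VY L (LDK L o), Comm.BA L (C2 L o), L⟩ : PairData).mem_lines hi)) (fun i hi => mem 14 (by omega) (mr hi))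
  · -- 17: `RL ≡ AS`
    refine (⟨LD.RL L (LDK L o), AS L o, L⟩ : ModAddU.PairData).isBlock_leibLines hGN hGL (hK.hRL.mono hΓ) (h.hAS.mono hΓ)
      (fun i hi => mem 15 (by omega) (mr hi)) (fun i hi => mem 16 (by omega) (mr hi)) fun i hi => ?_
    show ctx K (eqv ((LDK L o).inp (3 * L + i)) (o.inp (3 * L + i))) ∈ _
    rw [(LDK_inp hi).2.2.2]; exact rf (by omega) 3 (nv L o) (by simp) i hi
  · -- 18: `a ⊗ R(x⊕y) ≡ VS.out`
    exact ModAddU.MFI.isBlock_transLines hGL K (fun i hi => mem 8 (by omega) (Comm.mem_lines hL hi))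
      (fun i hi => mem 10 (by omega) ((⟨Comm.BA L (C3 L o), LD.VS L (LDK L o), L⟩ : PairData).mem_lines hi))
  · -- 19: `… ≡ RL.R`
    exact ModAddU.MFI.isBlock_transLines hGL K (fun i hi => mem 18 (by omega) (mr hi)) (fun i hi => mem 5 (by omega) (LD.mem_lines hi))
  · -- 20: `… ≡ AS.R`
    exact ModAddU.MFI.isBlock_transLines hGL K (fun i hi => mem 19 (by omega) (mr hi))
      (fun i hi => mem 17 (by omega) ((⟨LD.RL L (LDK L o), AS L o, L⟩ : ModAddU.PairData).mem_leibLines hi))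

/-- **The conclusion of the right-distributivity law**: `P_L(a ⊗ R(x⊕y))ᵢ ↔ R(AS)ᵢ`. [folklore] -/
theorem mem_lines {m i : ℕ} (hi : i < L) : ctx K (eqv ((Comm.M L (C3 L o) L).P L L i) ((AS L o).R L i)) ∈ lines L o K m := by
  have h21 : (segs L o K m).length = 21 := rfl
  exact List.mem_flatten.2 ⟨_, List.getElem_mem (n := 20) (by omega), List.mem_map.2 ⟨i, List.mem_range.2 hi, rfl⟩⟩

/-- **Size of the right-distributivity law**: `≤ 85200 (L+1)³ (|K| + 153)`. [folklore] -/
theorem proofSize_lines (hL : 0 < L) (o : Occ) (K : PropForm ℕ) (m : ℕ) :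
    proofSize (lines L o K m) ≤ 85200 * ((L + 1) * (L + 1) * (L + 1)) * (K.size + 153) := by
  have ht := fun (A B : Sub.View) => ModAddU.AssocKit.proofSize_transferLines A B K L
  have hlt := (lt L o).proofSize_lines (K := K)
  have hltL : (lt L o).L = L := rfl
  rw [hltL] at hlt
  have hLD := LD.proofSize_lines L (LDK L o) K m
  have hC := fun (O : Occ) => Comm.proofSize_lines (L := L) hL O K m
  have hR : proofSize (Adder.reflLines K ((List.range L).map o.inp ++ (List.range L).map (fun i => o.inp (L + i)) ++
      (List.range L).map (fun i => o.inp (2 * L + i)) ++ (List.range L).map (nv L o) ++ (List.range L).map ((LD.MS L (LDK L o)).R L))) =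
      5 * L * (K.size + 10) := by rw [Adder.proofSize_reflLines]; simp; ring
  have hQ := fun (V₁ V₂ : View) => (⟨V₁, V₂, L⟩ : PairData).proofSize_lines (K := K)
  have hT := fun (u w : ℕ → ℕ) => Comm.proofSize_mapEqv K u w L
  have hP := (⟨LD.RL L (LDK L o), AS L o, L⟩ : ModAddU.PairData).proofSize_leibLines (K := K)
  dsimp only at hQ hP
  simp only [lines, segs, List.flatten_cons, List.flatten_nil, proofSize_append, List.append_nil]
  unfold ModAddU.MFI.transLines ModAddU.MFI.symmLines
  nlinarith [ht (Comm.CmpB L (C1 L o)) ((LD.VX L (LDK L o)).CA L), ht (Comm.CmpB L (C2 L o)) ((LD.VY L (LDK L o)).CA L),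
    ht (Comm.CmpA L (C1 L o)) (Comm.CmpA L (C2 L o)), ht (Comm.CmpA L (C1 L o)) (Comm.CmpA L (C3 L o)), hlt, hLD,
    hC (C1 L o), hC (C2 L o), hC (C3 L o), hR, hQ (Comm.BA L (C3 L o)) (LD.VS L (LDK L o)), hQ (LD.VX L (LDK L o)) (Comm.BA L (C1 L o)),
    hQ (LD.VY L (LDK L o)) (Comm.BA L (C2 L o)),
    hT (fun i => (Comm.BA L (C1 L o)).P L L i) (fun i => (Comm.M L (C1 L o) L).P L L i),
    hT (fun i => (Comm.BA L (C2 L o)).P L L i) (fun i => (Comm.M L (C2 L o) L).P L L i),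
    hT ((LD.VX L (LDK L o)).P L L) ((Comm.M L (C1 L o) L).P L L), hT ((LD.VY L (LDK L o)).P L L) ((Comm.M L (C2 L o) L).P L L), hP,
    hT ((Comm.M L (C3 L o) L).P L L) ((LD.VS L (LDK L o)).P L L),
    hT ((Comm.M L (C3 L o) L).P L L) (fun i => (LD.RL L (LDK L o)).R L i),
    hT ((Comm.M L (C3 L o) L).P L L) (fun i => (AS L o).R L i), Nat.zero_le K.size, Nat.zero_le L]

/-- **The right-distributivity law in compositional form.** [cite: CookReckhow1979, §2; Krajicek1995, §9.2] -/
theorem yields (hGC : ∀ r ∈ Comm.rules, r ∈ G.rules) (hGO : ∀ r ∈ One.rules, r ∈ G.rules) (hGS : ∀ r ∈ Sys.glue, r ∈ G.rules)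
    (hGY : ∀ r ∈ Sys.sysRules, r ∈ G.rules) (hGN : ∀ r ∈ Netlist.rules, r ∈ G.rules) (hGA : ∀ r ∈ Adder.rules, r ∈ G.rules)
    (hGL : ∀ r ∈ Logic.rules, r ∈ G.rules) (hG : ∀ r ∈ ModAddU.assocRules, r ∈ G.rules) (hGM : ∀ r ∈ ModAddU.rules, r ∈ G.rules)
    (hGR : ∀ r ∈ rangeRules, r ∈ G.rules) (hGG : ∀ r ∈ ModAddU.glueRules, r ∈ G.rules) (hGK : ∀ r ∈ LD.maskRules, r ∈ G.rules)
    (hL : 0 < L) (h : RAvl L o K Γ) {m : ℕ} (hm : m + 2 ≤ L) (hzdef : ctx K (biimp (var (o.inp (4 * L))) (const false)) ∈ Γ)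
    (hlta : ctx K (neg (var ((Comm.CmpA L (C1 L o)).ge L L))) ∈ Γ) (hltx : ctx K (neg (var ((Comm.CmpB L (C1 L o)).ge L L))) ∈ Γ)
    (hlty : ctx K (neg (var ((Comm.CmpB L (C2 L o)).ge L L))) ∈ Γ)
    (hnh : ∀ i, m ≤ i → i < L → ctx K (neg (var (o.inp (3 * L + i)))) ∈ Γ) :
    G.Yields Γ (ctxSet K (eqW ((Comm.M L (C3 L o) L).P L L) (fun i => (AS L o).R L i) L)) (85200 * ((L + 1) * (L + 1) * (L + 1)) * (K.size + 153)) := by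
  refine Yields.of_isBlock (isBlock_lines hGC hGO hGS hGY hGN hGA hGL hG hGM hGR hGG hGK hL h hm hzdef hlta hltx hlty hnh) ?_
    (proofSize_lines hL o K m)
  rintro θ ⟨Lb, hLb, rfl⟩
  obtain ⟨i, hi, rfl⟩ := List.mem_map.1 hLb
  exact mem_lines (List.mem_range.1 hi)

end RD

end ModMulU

end Literature.Computability.MetaComplexity
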